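import Literature.Claims.NS.Moschandreou2021
import Mathlib.Analysis.SpecialFunctions.Trigonometric.Bounds
import Mathlib.Topology.Order.IntermediateValue
import HarnessLib

/-!
# D-0090 NS-claims sweep, row C05 `Moschandreou2021` — refuter's kernel file

Kills against the typed skeleton `Literature.Claims.NS.Moschandreou2021` (p465223, typist-3;
arXiv:2011.07419v4, TeX line locators):

* `ansatzVelocity_not_isLatticePeriodic` — the fixed horizontal field (8), TeX l.153–159, is
  ℤ³-periodic at NO time, for NO scaling `δ` and NO third component (translation by `e₂`
  changes `u_x` by `cos 4t* + 2 ≥ 1`);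
* `not_Step_1` — hence Step 1 ((4)–(6) l.128–144 with (8): «u : R⁺ × R³/Z³ → R³») fails as
  typed: FIRST FAILING STEP in dependency order, and the kernel face of the Clay-(B) delta
  (the ansatz is not a member of the periodic data/solution class);
* `composes_vacuous` — the typed `Composes` (`Step_1 → … → Step_7 → ClaimedTheorem`) is then
  provable ex falso: the LOGIC gap l.128–297 has no kernel face other than `not_Step_1`;
* `not_Step_2` — the «blow-up form» integral (13), l.190–193/l.247, is not monotone on `[0,∞)`
  for any `c₃`: its integrand is negative on `[0, 1/8]`, so `I(1/8) < 0 = I(0)`;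
* `not_Step_7` — the paper's Theorem 5, l.281–289: the Heaviside step `𝟙_{[0,∞)}` is monotone,
  continuous on the closed sets `ℝ ∖ (−ε/3, ε/3)` of co-measure `≤ ε`, and not continuous.

Steps 3–6 (Debreu, invariance of domain for `n = 1`, Rudin, Lusin) are known theorems and are
not attacked. Axioms: `propext`, `Classical.choice`, `Quot.sound` only.

WHAT THIS IS NOT: not a claim about NS regularity or blow-up; not a claim about any author
beyond the typed locator.
-/

set_option linter.dupNamespace false

open MeasureTheory Set Filter Topology
open Literature.Analysis.FluidPDE Literature.Claims.NS.Moschandreou2021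

namespace Summit.NavierStokesRegularity.NavierStokesRegularity.Theorems.Moschandreou2021

noncomputable section

/-! ## Step 1: the ansatz (8) is never lattice-periodic -/

/-- The horizontal field (8), TeX l.153–159, is not ℤ³-periodic at any time `t`, for any
scaling `δ` and any third component `u_z`: the `x`-component at `e₂` exceeds its value at the
origin by `cos (4δ²t) + 2 ≥ 1`. [cite: Moschandreou2021, eq. (8), l.153–159] -/
theorem ansatzVelocity_not_isLatticePeriodic (δ : ℝ) (uz : ℝ → EuclideanSpace ℝ (Fin 3) → ℝ)
    (t : ℝ) : ¬ IsLatticePeriodic (ansatzVelocity δ uz t) := by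
  intro hp
  have h := congrArg (fun v : EuclideanSpace ℝ (Fin 3) => v 0) (hp 1 0)
  simp [ansatzVelocity_apply_zero] at h
  linarith [Real.neg_one_le_cos (4 * (δ ^ 2 * t))]

/-- Refutes `Literature.Claims.NS.Moschandreou2021.Step_1` (§2.1.1 (4)–(6) TeX l.128–144 with
the field (8) l.153–159: «a solution … exists in the form u : R⁺ × R³/Z³ → R³»): at `δ = −1`
the offered ansatz velocity would have to be ℤ³-periodic at `t = 0`, which
`ansatzVelocity_not_isLatticePeriodic` excludes. FIRST FAILING STEP of the typed chain; the
kernel face of the Clay-(B) delta (data/solution class). The forcing, viscosity and NS-solution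
conjuncts of Step 1 are not used. [cite: Moschandreou2021, eqs. (4)–(8), l.128–159] -/
theorem not_Step_1 : ¬ Literature.Claims.NS.Moschandreou2021.Step_1 := by
  intro h
  obtain ⟨f, ν, uz, P, -, -, -, hper⟩ := h (-1) (by norm_num)
  exact ansatzVelocity_not_isLatticePeriodic (-1) uz 0 (hper 0 le_rfl)

/-- The typed composition `Composes : Step_1 → Step_2 → … → Step_7 → ClaimedTheorem` holds
VACUOUSLY once Step 1 is refuted (ex falso): the missing implication l.128–297 («every Clay (B)
datum evolves inside the ansatz») therefore has no kernel content beyond `not_Step_1`.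
[cite: Moschandreou2021, l.128–297] -/
theorem composes_vacuous : Literature.Claims.NS.Moschandreou2021.Composes := by
  intro h1
  exact (not_Step_1 h1).elim

/-! ## Step 2: the integral (13) decreases near `t = 0` -/

/-- On `[0, 1/2]` one has `sin x < cos x` (`sin x ≤ x ≤ 1/2 < 7/8 ≤ 1 − x²/2 ≤ cos x`).
[folklore] -/
theorem sin_sub_cos_neg {x : ℝ} (h0 : 0 ≤ x) (h1 : x ≤ 1 / 2) :
    Real.sin x - Real.cos x < 0 := by
  have hs := Real.sin_le h0
  have hc := Real.one_sub_sq_div_two_le_cos (x := x)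
  nlinarith

/-- `I_{c₃}(0) = 0`. [cite: Moschandreou2021, eq. (13), l.190–193] -/
theorem blowupIntegral_zero (c₃ : ℝ) : blowupIntegral c₃ 0 = 0 := by
  simp [blowupIntegral]

/-- `I_{c₃}(1/8) < 0` for EVERY `c₃`: the integrand `(sin 4s − cos 4s)·e^{2c₃(sin 4s − cos 4s)}`
of (13) is negative on `[0, 1/8]`. [cite: Moschandreou2021, eq. (13), l.190–193] -/
theorem blowupIntegral_one_eighth_neg (c₃ : ℝ) : blowupIntegral c₃ (1 / 8) < 0 := by
  have hcont : Continuous fun s : ℝ => (Real.sin (4 * s) - Real.cos (4 * s)) *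
      Real.exp (2 * c₃ * (Real.sin (4 * s) - Real.cos (4 * s))) := by
    fun_prop
  have hpos : 0 < ∫ s in (0 : ℝ)..(1 / 8), -((Real.sin (4 * s) - Real.cos (4 * s)) *
      Real.exp (2 * c₃ * (Real.sin (4 * s) - Real.cos (4 * s)))) := by
    refine intervalIntegral.intervalIntegral_pos_of_pos_on
      (hcont.neg.intervalIntegrable _ _) ?_ (by norm_num)
    intro s hs
    have hsc : Real.sin (4 * s) - Real.cos (4 * s) < 0 :=
      sin_sub_cos_neg (by linarith [hs.1]) (by linarith [hs.2])
    nlinarith [Real.exp_pos (2 * c₃ * (Real.sin (4 * s) - Real.cos (4 * s)))]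
  rw [intervalIntegral.integral_neg] at hpos
  unfold blowupIntegral
  linarith

/-- Refutes `Literature.Claims.NS.Moschandreou2021.Step_2` ((13) TeX l.190–193 and l.247: «for
c₃ large and positive the integral in Eq. (13) is an increasing function wrt t»): for every
threshold `c₀`, the integral with `c₃ = c₀` satisfies `I(1/8) < 0 = I(0)`, so it is not monotone
on `[0,∞)`. [cite: Moschandreou2021, eq. (13), l.190–193, l.247] -/
theorem not_Step_2 : ¬ Literature.Claims.NS.Moschandreou2021.Step_2 := by
  rintro ⟨c₀, hc⟩
  have h := hc c₀ le_rfl (Set.mem_Ici.mpr (le_refl (0 : ℝ)))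
    (Set.mem_Ici.mpr (by norm_num : (0 : ℝ) ≤ 1 / 8)) (by norm_num)
  rw [blowupIntegral_zero] at h
  linarith [blowupIntegral_one_eighth_neg c₀]

/-! ## Step 7 (the paper's Theorem 5): the Heaviside step -/

/-- The Heaviside step `𝟙_{[0,∞)}` (countermodel to Theorem 5, l.281–289). [folklore] -/
def heav (x : ℝ) : ℝ := if 0 ≤ x then 1 else 0

/-- `heav = 1` on `[0,∞)`. [folklore] -/
theorem heav_of_nonneg {x : ℝ} (h : 0 ≤ x) : heav x = 1 := by
  simp [heav, h]

/-- `heav = 0` on `(−∞,0)`. [folklore] -/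
theorem heav_of_neg {x : ℝ} (h : x < 0) : heav x = 0 := by
  simp [heav, not_le.mpr h]

/-- The Heaviside step is monotone. [folklore] -/
theorem heav_monotone : Monotone heav := by
  intro a b hab
  by_cases hb : 0 ≤ b
  · rw [heav_of_nonneg hb]
    unfold heav
    split_ifs <;> norm_num
  · have hb' : b < 0 := not_le.mp hb
    rw [heav_of_neg (lt_of_le_of_lt hab hb'), heav_of_neg hb']

/-- The Heaviside step is continuous at every `x ≠ 0` (locally constant there). [folklore] -/
theorem heav_continuousAt {x : ℝ} (hx : x ≠ 0) : ContinuousAt heav x := by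
  rcases lt_or_gt_of_ne hx with h | h
  · refine (continuousAt_const (y := (0 : ℝ))).congr ?_
    exact Filter.eventually_of_mem (Iio_mem_nhds h) fun y hy => (heav_of_neg hy).symm
  · refine (continuousAt_const (y := (1 : ℝ))).congr ?_
    exact Filter.eventually_of_mem (Ioi_mem_nhds h) fun y hy =>
      (heav_of_nonneg (le_of_lt hy)).symm

/-- The Heaviside step is not continuous on `ℝ` (no point with value `1/2` between
`heav (−1) = 0` and `heav 1 = 1`). [folklore] -/
theorem heav_not_continuous : ¬ Continuous heav := by
  intro hc
  have hsub := intermediate_value_univ (-1 : ℝ) 1 hc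
  rw [heav_of_neg (by norm_num : (-1 : ℝ) < 0), heav_of_nonneg (by norm_num : (0 : ℝ) ≤ 1)]
    at hsub
  obtain ⟨x, hx⟩ := hsub (show (1 / 2 : ℝ) ∈ Icc (0 : ℝ) 1 from ⟨by norm_num, by norm_num⟩)
  unfold heav at hx
  split_ifs at hx <;> norm_num at hx

/-- The hypothesis of Theorem 5 for the Heaviside step with `g = id`: for every `ε > 0` the closed
set `F = ℝ ∖ (−ε/3, ε/3)` has `m(Fᶜ) = 2ε/3 ≤ ε` and `heav` is continuous on `F`.
[cite: Moschandreou2021, Theorem 5, l.281–289] -/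
theorem heav_largeClosedSets (ε : ℝ) (hε : 0 < ε) :
    ∃ F : Set ℝ, IsClosed F ∧ volume Fᶜ ≤ ENNReal.ofReal ε ∧
      ContinuousOn ((Homeomorph.refl ℝ) ∘ heav) F := by
  refine ⟨(Ioo (-(ε / 3)) (ε / 3))ᶜ, isOpen_Ioo.isClosed_compl, ?_, ?_⟩
  · rw [compl_compl, Real.volume_Ioo]
    exact ENNReal.ofReal_le_ofReal (by linarith)
  · intro x hx
    have hx0 : x ≠ 0 := by
      rintro rfl
      exact hx ⟨by linarith, by linarith⟩
    exact (heav_continuousAt hx0).continuousWithinAt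

/-- Refutes `Literature.Claims.NS.Moschandreou2021.Step_7` (the paper's THEOREM 5, TeX
l.281–289: «h = g∘u_z : F → Z continuous and g a homeomorphism ⇒ u_z : X → Y continuous»):
countermodel `u = 𝟙_{[0,∞)}` (monotone), `g = id`, Lusin sets `ℝ ∖ (−ε/3, ε/3)` — continuity on
large closed sets does not propagate to the deleted small set.
[cite: Moschandreou2021, Theorem 5, l.281–289] -/
theorem not_Step_7 : ¬ Literature.Claims.NS.Moschandreou2021.Step_7 := fun h =>
  heav_not_continuous (h heav heav_monotone (Homeomorph.refl ℝ) heav_largeClosedSets)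

end

end Summit.NavierStokesRegularity.NavierStokesRegularity.Theorems.Moschandreou2021
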